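import Summits.QuantumAdvantage.QuantumAdvantage.Theorems.CharDialPlaneDivAscentD2
import HarnessLib

/-!
# PlaneDivAscent — PART F1 (+ F2): the THREE-BLOCK COUNTEREXAMPLE — the uniform codimension law `K = 3` is FALSE
(cell decomp-qadv, lens 6 «barrier-complement carving», g21 REV3; tree-ready, Prop-definition-free; needs Part A
(`planeCount`, `perIn`) and Part D (`law_iff_top`).)

For every prime `p ≥ 7` the set
`S = {y : y₃ = ι y₂} ⊔ {y : y₃ - 2 = ι y₀} ⊔ {y : y₃ - 4 = ι y₁} ⊆ 𝔽_p⁴`, `ι c = [c ≠ 0]`,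
— three disjoint 2-form cylinders with `p`-point bases `{(ι c, c)}` on the slab pairs `y₃ ∈ {0,1}, {2,3}, {4,5}` —
has all parametrised plane counts `≡ 0 (mod p)` (`planeCount_S3_dvd`: an affine `2 × 2` preimage of a `p`-set has
size `≡ 0`, `dvd_card_affine_preimage`; singular matrices give unions of cosets of a kernel vector,
`card_dvd_of_translate_invariant`) and NO nonzero period (`not_period_S3`, eight explicit witnesses).
Consequences: `exists_planeDiv_periodless_four`; ★ `not_law_three` — through Part D's dimension elimination the
codimension law with the uniform constant `K = 3` fails for every `p ≥ 7` (the finite-field core of the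
second structure law has `K_field(p) ≥ 4`; the same blocks in `𝔽_p^m`, `m - 1` of them on `2m - 2 ≤ p` slabs, give
`K_field(p) ≥ (p+1)/2` on paper, so no constant uniform in `p` exists; `p = 5`, dimension 4 is not covered and
stays with census instance K44).
-/

set_option autoImplicit false

namespace Summit.QuantumAdvantage.AdviceFreeQNC0.PlaneDiv

open Finset Module

section ThreeBlock

variable {p : ℕ} [Fact p.Prime]

/-! ### Free translations of `𝔽_p × 𝔽_p` -/

/-- A finset of `𝔽_p × 𝔽_p` invariant under a nonzero translation has cardinality divisible by `p`. -/
theorem card_dvd_of_translate_invariant (κ : ZMod p × ZMod p) (hκ : κ ≠ 0) :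
    ∀ T : Finset (ZMod p × ZMod p), (∀ v, v + κ ∈ T ↔ v ∈ T) → p ∣ T.card := by
  intro T
  induction T using Finset.strongInduction with
  | H T ih => ?_
  intro hT
  rcases T.eq_empty_or_nonempty with h | ⟨v, hv⟩
  · simp [h]
  set O : Finset (ZMod p × ZMod p) := Finset.univ.image fun m : ZMod p => v + m • κ with hO
  have hmemT : ∀ m : ZMod p, v + m • κ ∈ T := by
    intro m
    obtain ⟨k, rfl⟩ : ∃ k : ℕ, (k : ZMod p) = m := ⟨m.val, ZMod.natCast_zmod_val m⟩
    induction k with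
    | zero => simpa using hv
    | succ k ihk =>
        have := (hT (v + (k : ZMod p) • κ)).mpr ihk
        simpa [add_smul, add_assoc, Nat.cast_succ] using this
  have hOsub : O ⊆ T := by
    intro w hw
    rcases Finset.mem_image.mp hw with ⟨m, -, rfl⟩
    exact hmemT m
  have hOcard : O.card = p := by
    rw [hO, Finset.card_image_of_injective _ ?_]
    · simp [ZMod.card]
    · intro m m' h
      have h' : (m - m') • κ = 0 := by
        rw [sub_smul, sub_eq_zero]; exact add_left_cancel h
      rcases smul_eq_zero.mp h' with h0 | h0
      · exact sub_eq_zero.mp h0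
      · exact absurd h0 hκ
  have hvO : v ∈ O := Finset.mem_image.mpr ⟨0, Finset.mem_univ _, by simp⟩
  have hinvO : ∀ w, w + κ ∈ O ↔ w ∈ O := by
    intro w; constructor
    · intro hw
      rcases Finset.mem_image.mp hw with ⟨m, -, hm⟩
      refine Finset.mem_image.mpr ⟨m - 1, Finset.mem_univ _, ?_⟩
      have : v + m • κ - κ = w := by rw [hm]; simp
      rw [← this, sub_smul, one_smul]; abel
    · intro hw
      rcases Finset.mem_image.mp hw with ⟨m, -, hm⟩
      refine Finset.mem_image.mpr ⟨m + 1, Finset.mem_univ _, ?_⟩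
      rw [add_smul, one_smul, ← add_assoc, hm]
  have hsub : T \ O ⊂ T := Finset.sdiff_ssubset hOsub ⟨v, hvO⟩
  have hinv' : ∀ w, w + κ ∈ T \ O ↔ w ∈ T \ O := by
    intro w; simp only [Finset.mem_sdiff]; rw [hT w, hinvO w]
  have hdvd := ih _ hsub hinv'
  have hcard : (T \ O).card + O.card = T.card := Finset.card_sdiff_add_card_eq_card hOsub
  rw [← hcard, hOcard]
  exact dvd_add hdvd (dvd_refl p)

/-! ### Affine preimages under a `2 × 2` matrix -/

/-- `#{(s,t) : (u + sα + tβ, w + sγ + tδ) ∈ A}` is divisible by `p` whenever `p ∣ #A`: an invertible matrix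
gives exactly `#A`, a singular one gives a union of cosets of a nonzero kernel vector. -/
theorem dvd_card_affine_preimage (A : Finset (ZMod p × ZMod p)) (hA : p ∣ A.card)
    (u w α β γ δ : ZMod p) :
    p ∣ (Finset.univ.filter fun st : ZMod p × ZMod p =>
      (u + st.1 * α + st.2 * β, w + st.1 * γ + st.2 * δ) ∈ A).card := by
  set f : ZMod p × ZMod p → ZMod p × ZMod p :=
    fun st => (u + st.1 * α + st.2 * β, w + st.1 * γ + st.2 * δ) with hf
  by_cases hdet : α * δ - β * γ = 0
  · obtain ⟨κ, hκ0, hκ1, hκ2⟩ : ∃ κ : ZMod p × ZMod p,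
        κ ≠ 0 ∧ κ.1 * α + κ.2 * β = 0 ∧ κ.1 * γ + κ.2 * δ = 0 := by
      by_cases hα : α = 0
      · by_cases hγ : γ = 0
        · exact ⟨(1, 0), by simp, by simp [hα], by simp [hγ]⟩
        · have hβ : β = 0 := by
            have hβγ : β * γ = 0 := by
              have : -(β * γ) = 0 := by rw [← hdet, hα]; ring
              exact neg_eq_zero.mp this
            exact (mul_eq_zero.mp hβγ).resolve_right hγ
          refine ⟨(δ, -γ), ?_, ?_, ?_⟩
          · intro h; exact hγ (by simpa using congrArg Prod.snd h)
          · rw [hα, hβ]; ring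
          · ring
      · refine ⟨(β, -α), ?_, ?_, ?_⟩
        · intro h; exact hα (by simpa using congrArg Prod.snd h)
        · ring
        · linear_combination (-1 : ZMod p) * hdet
    apply card_dvd_of_translate_invariant κ hκ0
    intro v
    simp only [Finset.mem_filter, Finset.mem_univ, true_and, Prod.fst_add, Prod.snd_add]
    have h1 : u + (v.1 + κ.1) * α + (v.2 + κ.2) * β = u + v.1 * α + v.2 * β := by
      linear_combination hκ1
    have h2 : w + (v.1 + κ.1) * γ + (v.2 + κ.2) * δ = w + v.1 * γ + v.2 * δ := by
      linear_combination hκ2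
    rw [h1, h2]
  · have hinj : Function.Injective f := by
      intro v v' h
      simp only [hf, Prod.mk.injEq] at h
      obtain ⟨h1, h2⟩ := h
      have e1 : (v.1 - v'.1) * (α * δ - β * γ) = 0 := by linear_combination δ * h1 - β * h2
      have e2 : (v.2 - v'.2) * (α * δ - β * γ) = 0 := by linear_combination (-γ) * h1 + α * h2
      have d1 := (mul_eq_zero.mp e1).resolve_right hdet
      have d2 := (mul_eq_zero.mp e2).resolve_right hdet
      exact Prod.ext (sub_eq_zero.mp d1) (sub_eq_zero.mp d2)
    have hsurj : Function.Surjective f := Finite.surjective_of_injective hinj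
    have hcard : (Finset.univ.filter fun st : ZMod p × ZMod p => f st ∈ A).card = A.card := by
      apply Finset.card_bij (fun st _ => f st)
      · intro st hst; exact (Finset.mem_filter.mp hst).2
      · intro st _ st' _ h; exact hinj h
      · intro y hy
        obtain ⟨st, rfl⟩ := hsurj y
        exact ⟨st, Finset.mem_filter.mpr ⟨Finset.mem_univ _, hy⟩, rfl⟩
    show p ∣ (Finset.univ.filter fun st : ZMod p × ZMod p => f st ∈ A).card
    rw [hcard]; exact hA

/-! ### Small numerals in `ZMod p`, `p ≥ 7` -/

/-- `k ≠ 0` in `ZMod p` for `0 < k < p`. -/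
theorem natCast_ne_zero_of_lt {k : ℕ} (hk0 : 0 < k) (hkp : k < p) : ((k : ℕ) : ZMod p) ≠ 0 := by
  intro h
  have := (ZMod.natCast_eq_zero_iff k p).mp h
  exact absurd (Nat.le_of_dvd hk0 this) (by omega)

/-- `2 ≠ 0` in `ZMod p`, `p ≥ 7`. -/
theorem two_ne_zero' (hp : 7 ≤ p) : (2 : ZMod p) ≠ 0 := by
  simpa using natCast_ne_zero_of_lt (p := p) (k := 2) (by norm_num) (by omega)
/-- `3 ≠ 0` in `ZMod p`, `p ≥ 7`. -/
theorem three_ne_zero' (hp : 7 ≤ p) : (3 : ZMod p) ≠ 0 := by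
  simpa using natCast_ne_zero_of_lt (p := p) (k := 3) (by norm_num) (by omega)
/-- `4 ≠ 0` in `ZMod p`, `p ≥ 7`. -/
theorem four_ne_zero' (hp : 7 ≤ p) : (4 : ZMod p) ≠ 0 := by
  simpa using natCast_ne_zero_of_lt (p := p) (k := 4) (by norm_num) (by omega)
/-- `5 ≠ 0` in `ZMod p`, `p ≥ 7`. -/
theorem five_ne_zero' (hp : 7 ≤ p) : (5 : ZMod p) ≠ 0 := by
  simpa using natCast_ne_zero_of_lt (p := p) (k := 5) (by norm_num) (by omega)

end ThreeBlock

end Summit.QuantumAdvantage.AdviceFreeQNC0.PlaneDiv
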